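import Mathlib
import Summits.CriticalPhenomena.PercolationContinuityZ3.Theses.PercMinContact

/-!
# Route PercMinContact — support item `ExponentGlue`

`MinContactExponent → SwallowTail`: a power-law bound `m(u) ≤ C (p_c - u)^{-a₀}` with `a₀ < 1` on
`[0, p_c)` makes the min-contact function `m` Lebesgue-integrable on `(0, p_c)`, because
`u ↦ (p_c - u)^{-a₀}` is integrable near `p_c` (exponent `> -1`). Pure real analysis plus
`0 < p_c(ℤ³) < 1` (Grimmett 1999 Thm (1.10), proved in the tree as
`Literature.Probability.Percolation.Grimmett1999_criticalProb_pos_lt_one_holds`); monotonicity of the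
lower Lebesgue integral needs no measurability of `m`.
-/

namespace Summit.CriticalPhenomena.PercolationContinuityZ3.Theorems

open MeasureTheory Set

/-- A real function of the form `u ↦ C * (b - u) ^ r` with `-1 < r` is integrable on `(a, b)`
(Lebesgue measure), for any `a ≤ b`. -/
theorem integrableOn_const_mul_rpow_sub_Ioo (C a b r : ℝ) (hab : a ≤ b) (hr : -1 < r) :
    IntegrableOn (fun u : ℝ => C * (b - u) ^ r) (Ioo a b) volume := by
  have h1 : IntervalIntegrable (fun x : ℝ => x ^ r) volume 0 (b - a) :=
    intervalIntegral.intervalIntegrable_rpow' hr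
  have h2 : IntervalIntegrable (fun x : ℝ => (b - x) ^ r) volume (b - 0) (b - (b - a)) :=
    h1.comp_sub_left b
  simp only [sub_zero, sub_sub_cancel] at h2
  have h3 : IntegrableOn (fun x : ℝ => (b - x) ^ r) (Ioo a b) volume :=
    (intervalIntegrable_iff_integrableOn_Ioo_of_le hab).1 h2.symm
  exact h3.const_mul C

/-- `∫⁻ u in (a,b), ofReal (C * (b - u) ^ r) < ∞` whenever `-1 < r` and `a ≤ b`. -/
theorem lintegral_ofReal_const_mul_rpow_sub_Ioo_lt_top (C a b r : ℝ) (hab : a ≤ b) (hr : -1 < r) :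
    (∫⁻ u in Ioo a b, ENNReal.ofReal (C * (b - u) ^ r)) < ⊤ :=
  (integrableOn_const_mul_rpow_sub_Ioo C a b r hab hr).setLIntegral_lt_top

/-- **ExponentGlue** (route PercMinContact, item stmt-CriticalPhenomena-11502):
`MinContactExponent → SwallowTail`. With `p := 0 < p_c(ℤ³)`, monotonicity of the set-lintegral
and the bound `m(u) ≤ ofReal (C (p_c - u)^{-a₀})` on `(0, p_c)` reduce the claim to
`∫_{(0,p_c)} C (p_c - u)^{-a₀} du < ∞`, which holds since `-a₀ > -1`. -/
theorem ExponentGlue_proof :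
    Summit.CriticalPhenomena.PercolationContinuityZ3.Theses.PercMinContact.ExponentGlue := by
  unfold Summit.CriticalPhenomena.PercolationContinuityZ3.Theses.PercMinContact.ExponentGlue
    Summit.CriticalPhenomena.PercolationContinuityZ3.Theses.PercMinContact.MinContactExponent
    Summit.CriticalPhenomena.PercolationContinuityZ3.Theses.PercMinContact.SwallowTail
  rintro ⟨C, a₀, ha₀, hbound⟩
  have hpc : 0 < Literature.Probability.Percolation.criticalProb
      (Literature.Probability.LatticeModels.zdGraph 3)
      (0 : Literature.Probability.LatticeModels.Site 3) :=
    (Literature.Probability.Percolation.Grimmett1999_criticalProb_pos_lt_one_holds 3 (by norm_num)).1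
  refine ⟨0, hpc, ?_⟩
  calc _ ≤ ∫⁻ u in Ioo (0 : ℝ) (Literature.Probability.Percolation.criticalProb
          (Literature.Probability.LatticeModels.zdGraph 3)
          (0 : Literature.Probability.LatticeModels.Site 3)),
          ENNReal.ofReal (C * (Literature.Probability.Percolation.criticalProb
            (Literature.Probability.LatticeModels.zdGraph 3)
            (0 : Literature.Probability.LatticeModels.Site 3) - u) ^ (-a₀)) :=
        setLIntegral_mono' measurableSet_Ioo (fun u hu => hbound u hu.1.le hu.2)
    _ < ⊤ := lintegral_ofReal_const_mul_rpow_sub_Ioo_lt_top C 0 _ (-a₀) hpc.le (by linarith)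

end Summit.CriticalPhenomena.PercolationContinuityZ3.Theorems
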